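import Summits.QuantumFields.YangMills.Theorems.BalabanUVNodesK0AxTangentSocketModGaugeComb

/-!
# BalabanUVNodes ∕ K0ᴬ — THE CONSTRAINT HALF OF THE JUNCTION, FIRST ORDER, MODULO GAUGE: (J-cons″) AT THE FLAT LOG CHART IS A THEOREM, and the (R-a) road at `Ψ₀` gets a
contentful final (MINT NODE O, lens-1 g11, FILE 11; `--supports stmt-QuantumFields-27238 --as helper`)

LANDING NOTE (porter ▶ PTC-1 g4, 2026-08-31; AUTHORSHIP = ◇ lens-1 g11 «cauchy-analytic», HOME sketch `nodeO-cover/LENS-1g11-TangentSocketModGauge-v1.lean` sha16 3f857e80419ca706 · 570 l. · 16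
thm, no `def`, 0 sorry (CANDIDATE 9 = FILE 11: the THEOREM edition — (J-cons″) AT THE FLAT LOG CHART IS A THEOREM (`flatConsModGauge_msChart_flat`, comb re-gauging `φ₀ := Λ_{k+1}(↑Y) ∘ iterBlockOf
(k+1)`), the MOD-GAUGE socket, and the (R-a) road's CONTENTFUL final at Ψ₀ `rootedReceipts_of_tokens_atScale_flatLogChart_modGauge` with NO dictionary displayed; ◆'s CUT RULE honoured: no
`FlatConsDictionary … Ψ₀ _` binder, none of the four vacuous finals consumed)): the HOME file exceeds the gate's 400-line cap, so it is landed as TWO files by a MECHANICAL split at the §3∕§4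
boundary (generator `work/gen/build_split_modgauge.py` of this seat; docstrings, statements and proofs BYTE-IDENTICAL; imports as the monolith): FILE 11A
`…Theorems/BalabanUVNodesK0AxTangentSocketModGaugeComb.lean` = header + §1 Plumbing + §2 CombRegauge + §3 DatumVelocity (8 thm), FILE 11B `…Theorems/BalabanUVNodesK0AxTangentSocketModGauge.lean`
(◇'s basename) = header + `import …K0AxTangentSocketModGaugeComb` + the same preamble + §4 ModGaugeSocket + §5 FlatLogChartFinal (8 thm). THIS IS FILE 11B (the other:
`…K0AxTangentSocketModGaugeComb`).  Landed after ✓p823070 `…ConsNeg` and ★★ DEF-1 g38's ✓p823088 `…CritFlat` (`flatCritDictionary_flatLogChart` cited by name); ◆ CRIT-1 g38's cut: «CUT — CANDIDATE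
9 → GO VERBATIM, filed as PTC-1's mechanical SPLIT 11A + 11B (570 l. > the cap ⇒ split REQUIRED); axioms standard on ALL 16 (guarded); J5′: no def∕private∕options; J4 16 × 0; J1′ CUT RULE honoured
(no consumed `FlatConsDictionary … Ψ₀` binder); MECHANICAL BINDER CUSTODY of the ★★★★ final vs ✓Onto :155 — 23 binders identical, ONLY-in-Onto = {Jcrit, Jcons}, ONLY-here = {hρ8}, conclusion
EQUAL; (Q-ord): `∃ φ₀` INSIDE `∀ Y`; SAME-WALL: SURVIVES, priced — both J-letters are now THEOREMS at Ψ₀, so the final at Ψ₀ is NON-VACUOUS modulo the displayed tokens» (nodeO STATUS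
2026-08-31T12:56:21Z); ◇ lens-1 g11 SPLIT ACK (l.5445); `--supports stmt-QuantumFields-27238 --as helper` (NO `--workitem`; kind proof).  HONEST (porter): calculus ∕ linear algebra over tree facts
+ CONDITIONAL finals over DISPLAYED tokens (KNIT tokens, `RegimeTok`, (s-exp) letters, `ρ₈ ⊂ 𝔰𝔲(2)`, D1 ⟨27930⟩) inhabited NOWHERE as a package; (C-tab-opt) STRUCK; nothing of Bałaban asserted,
ported, discharged or refuted; K0ᴬ stmt-QuantumFields-27238 ∕ K0⁷ 20541 OPEN — NOTHING of them proved; NODE O 0∕1; COUNT 8∕28 · K 1∕4 UNMOVED; finite 𝕋⁴ at fixed ε — NOT continuum ∕ OS ∕ Clay; the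
Yang–Mills mass gap is NOT proved by any of this.

WHAT DIED AND WHAT REPLACES IT.  The EXACT flat constraint dictionary (J-cons′) `FlatConsDictionary F θ k K Ψ₀ datum` («`DΨ₀(0)Y = D datum(0)(respDir a l)` ⟹ the straight
[B6]-constraint rows `QE(univDomains)(re∕im ξ⁻¹Y_{ii′}) = (ρ₈ bV a)_{ii′} • windowSrc univ l`») is FALSE at the canonical flat logarithmic chart
`Ψ₀ := msChart F 2 K (k+1) (atScale (k+1)) Ū(1) 1` (✓`not_flatConsDictionary_msChart_flat`: `DΨ₀(0)` kills pure gradients, the straight rows do not), so the four landed `Ψ₀`-finals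
(✓`rootedReceipts_of_tokens_atScale_flatLogChart`, ✓`…_onto`, ✓`…_lie`, ✓`…_recordScheme`) are vacuous as typed.  The repaired letter (J-cons″) asks for the rows only MODULO AN
UNRESTRICTED SITE POTENTIAL `φ₀ : Site 0 → (Fin 2 → Fin 2 → ℂ)` — exactly what the mod-gauge receipt (C-cons) `RootedResponseConstraintModGaugeAt` and its chart twin
`ChartResponseCriticalModGaugeAt` (✓`criticalModGauge_iff_chart`) consume — and AT `Ψ₀` WITH DATUM `Ψ₀ ∘ X` IT IS A THEOREM, proved here (§4 ★★★`flatConsModGauge_msChart_flat`).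

THE MECHANISM (§2–§3).  (i) COMB REGAUGE (§2): for every Lie field `Y` on the fine bonds, the comb functional `Λ_{k+1}(↑Y)` of k0-s1-w1's ✓`qLin_one_eq_sub_comb`, pulled back along
`iterBlockOf (k+1)` to a site potential `φ₀` on the fine lattice, turns the PLAIN iterated bond average of `ξ⁻¹(Y − ∂φ₀)` into the linearised averaging map: `bondAvgIter (k+1) (ξ⁻¹(Y − ∂φ₀)) c
= qLin (k+1) 1 Y c` (★`exists_blockGauge_bondAvgIter_eq_qLin`; ✓`bondAvgIter_grad`, `siteAvgIter ∘ iterBlockOf = id`); read through [B6]'s `QE` on `univDomains` (only the top level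
carries constraints, ✓`lamBond_windowDomains_*`) this gives the mod-gauge rows from any prescription of `qLin Y` on the coarse bonds (★`exists_blockGauge_QE_eq_of_qLin_eq`).
(ii) DATUM VELOCITY (§3): the KNIT `range` token's eventual identity `Ū^{k+1}(expChart 1 (X B)) = unitField B` near `B = 0` (✓`eventually_avgFamily_expChart_eq_unitField`), `X 0 = 0`,
`X` differentiable at `0` and `ρ₈ ∈ 𝔰𝔲(2)` force, by the chain rule against the explicit CLM `B ↦ suProj (ρ₈ (B c.dir c.src))` (✓`mlog_exp`, ✓`fderiv_msChart_apply_eq_suProj_qLin_of_smallBelow`),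
`qLin (k+1) 1 (DX(0)·respDir a l) c = [c = ⟨l.2,l.1⟩] ρ₈(bV a)` (★★`qLin_fderiv_respDir_eq`); and `DΨ₀(0)Y = DΨ₀(0)Y′ ⟹ qLin Y = qLin Y′` (★`qLin_eq_of_fderiv_msChart_flat_eq`).
(iii) §4: (i)+(ii) ⟹ ★★★`flatConsModGauge_msChart_flat` — (J-cons″)@`Ψ₀`; the MOD-GAUGE TANGENT SOCKET ★★`chartResponseCriticalModGauge_of_tangentData` (pure logic, twin of
✓`chartResponseWeaklyCritical_of_tangentData`; criticality is blind to `φ₀` by ✓`dcE_reBond_mul_sub_grad`); receipts ★★★`rootedReceipts_of_chart_criticalModGauge`; the socket plugged into a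
flat tangent-critical exp-chart family for a GENERIC `Ψ` with (J-crit′) + (J-cons″) displayed (★★★`chartResponseCriticalModGauge_of_flatCriticalExpChartFamily`) and AT `Ψ₀` WITH NO
DICTIONARY DISPLAYED (★★★`…_flatLogChart`: (J-crit′)@`Ψ₀` is DEF-1's ✓`flatCritDictionary_flatLogChart`, (J-cons″)@`Ψ₀` is §4); ★★★`rootedReceipts_of_flatExpChartFamily_flatLogChart`.
(iv) §5: ★★★★`rootedReceipts_of_tokens_atScale_flatLogChart_modGauge` — the (R-a) road at `Ψ₀` RE-THREADED (✓Near ∕ ✓Dock ∕ ✓Psi lemmas reused by name): DISPLAYED = `k + 2 ≤ m + K` ·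
N07's KNIT tokens `(Kc range covers sol_of_isMinOn star_mem star_isMinOn)` + `RegimeTok` + domain letter · the datum family `W` · (s-exp) `hSX` with `X 0 = 0`, `X ∈ C²` at `0` · `ρ₈ ∈ 𝔰𝔲(2)`
— NO `Ψ`-letter, NO (J-crit′), NO (J-cons′) ⟹ (∀ a l, the four rooted receipts (C-wcg) ∧ (C-orb) ∧ (C-crit) ∧ (C-cons)) ∧ TokP9reg♭ᵣ; and ✓`not_flatConsDictionary_msChart_flat` with its
onto-ness discharged (`…_of_le`).  The downstream specialisations (✓`…_lie`, ✓`…_recordScheme`: `X := S.lieExpo ∘ unitField`, the scheme of record) re-thread by the same one-line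
substitution of this final for ✓`…_onto` — left to the porter ∕ successor (their displayed `Jcrit Jcons` binders simply drop).

HONEST.  Finite-dimensional calculus and lattice bookkeeping over the tree's own operators ([B6] Sect. A `QE ∕ dcE ∕ windowSrc`, k0-s1-w1's flat averaging dictionary, n07-e's `msChart`,
dag-n12's onto-ness, def-Y's tokens) — every input a kernel-checked tree theorem; CONDITIONAL over the DISPLAYED KNIT ∕ (s-exp) letters, inhabited NOWHERE in the tree; nothing of Bałaban
([15] Thm 1, Prop. 3, Prop. 6–9, (44)–(48), (82)–(83), (176)–(178); [14] (2.6)–(2.8), (2.35); [RS] (1.113)–(1.114); [III] (2.10)–(2.13); [I] (1.20), (4.35)) is asserted, ported or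
discharged beyond what the tree already proves; (C-tab-opt) stays STRUCK (№543) and (J-cons′)@`Ψ₀` stays REFUTED-MISSTATED (◆ l.5399) — this file is its mod-gauge REPAIR, not a
re-filing; K0ᴬ `stmt-QuantumFields-27238` ∕ K0⁷ `stmt-QuantumFields-20541` remain OPEN — NOTHING of them is proved here; NODE O 0∕1; COUNT 8∕28 · K 1∕4 UNMOVED; finite 𝕋⁴_{L^K} at
fixed ε — NOT continuum ∕ OS ∕ Clay; **the Yang–Mills mass gap is NOT proved by any of this.**  No `sorry`, no `def`, no `instance ∕ notation ∕ set_option`; standard axioms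
`[propext, Classical.choice, Quot.sound]`.
-/

noncomputable section

open Filter Topology
open scoped BigOperators Matrix.Norms.L2Operator
open scoped InnerProductSpace

namespace Summit.QuantumFields.YangMills.Theorems.K0AxCtabUniq

open Literature.MathematicalPhysics.QuantumFieldTheory.Balaban1983to89
open LatticeFieldCalculus B6SectADomainsV1 B6SectAOperatorsV1 B6SectAVectorModelV1 B6SectACriticalPointV1
open Literature.MathematicalPhysics.QuantumFieldTheory.Balaban1983to89.T4Continuum (T4Family)
open Literature.MathematicalPhysics.QuantumFieldTheory.Balaban1983to89.Node00
open T4RootedResidualGauge (rootGauge)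
open GaugeField (gaugeAct)
open B12GaugeOrbits021 (IsResidual OrbitRel)
open B11Prop6Scheme (mapT)
open Summit.QuantumFields.YangMills.Theorems.K0RecordFormatNames
open Summit.QuantumFields.YangMills.Theorems.K0AxRootGrad
open T4AdjointCovarianceUnitary (lieSU mem_lieSU_iff exp_mem_specialUnitaryGroup_of_mem_lieSU)
open B15DeterminingSets (DetSet MSField atScale embIter avgFamily bondsOf)
open B5Eq118OneStroke (iterBlockOf iterBlock mem_iterBlock siteAvgIter_eq_blockSum card_iterBlock)
open B5Eq120IterProof (bondAvgIter_grad)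
open B6SectAOntoV1 (bondAvgIterLin bondAvgIterLin_apply)
open Literature.MathematicalPhysics.QuantumFieldTheory.BalabanImbrieJaffe1984to88.BIJ85AxialPropagator411 (BondSpace)
open Literature.MathematicalPhysics.QuantumFieldTheory.BalabanImbrieJaffe1984to88.BIJ88RT51Background (iterBlockOf_embIter)
open Summit.QuantumFields.YangMills.Theorems.ChartHInv (exists_combFamily bondAvgIter_comp_apply)
open Summit.QuantumFields.YangMills.Theorems.K0Stub1FlatAveragingDictionary (qLin_one_eq_sub_comb combFamily_mem_lieSU)
open Summit.QuantumFields.YangMills.Theorems.PortU8 (exists_iterBlockOf_eq lamBond_windowDomains_zero_iff not_lamBond_windowDomains_mid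
  lamBond_windowDomains_top_iff windowSrc_apply)
open Summit.QuantumFields.YangMills.BalabanUVNodes.N07LinearisedAveragingKernel (qLin_mem_lieSU)
open Summit.QuantumFields.YangMills.BalabanUVNodes.N12MinimiserFamilyAtRecordBjNoPlaqGuard (fderiv_msChart_apply_eq_suProj_qLin_of_smallBelow)
open Summit.QuantumFields.YangMills.Theorems.BalabanUVNodesPortS1 (unitField_zero)
open MatrixLog (mlog)
open Literature.MathematicalPhysics.QuantumFieldTheory.Balaban1983to89.B7BlockAvgLog (mlog_exp)

variable (F : T4Family) (θ : Stage13Params F 2)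

/-! ## §4  (J-cons″) AT THE FLAT LOG CHART IS A THEOREM, and THE MOD-GAUGE SOCKET -/

section ModGaugeSocket

/-- ★★★ **(J-cons″) AT `Ψ₀`, DISCHARGED**: at the canonical flat logarithmic chart `Ψ₀ := msChart F 2 K (k+1) (atScale (k+1)) Ū(1) 1` with datum `Ψ₀ ∘ X`, every Lie field `Y` whose
linearised chart value is the datum velocity of `respDir a l` has — MODULO AN UNRESTRICTED SITE POTENTIAL `φ₀` (the comb functional of `Y`) — [B6]-constraint rows
`QE(univDomains)(re∕im ξ⁻¹(Y − ∂φ₀)_{ii′}) = (ρ₈(bV a))_{ii′}.re∕im • windowSrc univ l`.  Inputs with content: the KNIT `range` token's eventual identity `hV`, `X 0 = 0`, `X`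
differentiable at `0`, `ρ₈` valued in `𝔰𝔲(2)`.  (The exact `φ₀ = 0` edition (J-cons′) is FALSE here: ✓`not_flatConsDictionary_msChart_flat`.) [cite: Balaban1985Variational, (44)–(48) p.285,
(15) p.280, (174) p.305, Prop. 9 p.309; Balaban1984PropagatorsII, (2.6)–(2.7) p.224; Balaban1987RG1, (1.20) p.264, (4.35) p.290] -/
theorem flatConsModGauge_msChart_flat (K k : ℕ) (hk : k + 1 ≤ (F.P K).m + (F.P K).K)
    (hρ8 : letI := θ.instVβ₁; letI := θ.instVβ₂; ∀ v : θ.Vβ, θ.ρ8 v ∈ lieSU (Fin 2))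
    (X : (Fin (F.P K).d → Site (F.P K) (k + 1) → θ.Vβ) → PBond (F.P K) 0 → lieSU (Fin 2))
    (hX₀ : letI := θ.instVβ₁; letI := θ.instVβ₂; X 0 = 0) (hXd : letI := θ.instVβ₁; letI := θ.instVβ₂; DifferentiableAt ℝ X 0)
    (hV : letI := θ.instVβ₁; letI := θ.instVβ₂;
      ∀ᶠ B in 𝓝 (0 : Fin (F.P K).d → Site (F.P K) (k + 1) → θ.Vβ),
        avgFamily (avOfRecord F 2 K) (expChart (1 : GaugeField (F.P K) 0 (SU 2)) (X B)) (k + 1) = unitField F θ k K B)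
    (a : θ.ιβ) (l : RespLabel F k K) (Y : PBond (F.P K) 0 → lieSU (Fin 2))
    (hY : letI := θ.instVβ₁; letI := θ.instVβ₂;
      fderiv ℝ (msChart F 2 K (k + 1) (atScale (k + 1)) (avgFamily (avOfRecord F 2 K) 1) (1 : GaugeField (F.P K) 0 (SU 2))) 0 Y =
        fderiv ℝ (fun B => msChart F 2 K (k + 1) (atScale (k + 1)) (avgFamily (avOfRecord F 2 K) 1) (1 : GaugeField (F.P K) 0 (SU 2)) (X B)) 0
          (respDir F θ k K a l)) :
    ∃ φ₀ : Site (F.P K) 0 → Fin 2 → Fin 2 → ℂ, ∀ i i' : Fin 2,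
      QE (univDomains F k K hk) (reBond F K fun b => (((F.P K).eta (k + 1))⁻¹ : ℂ) *
          (((Y b : lieSU (Fin 2)) : Matrix (Fin 2) (Fin 2) ℂ) i i' - (φ₀ b.tgt i i' - φ₀ b.src i i'))) =
        (θ.ρ8 (θ.bV a) i i').re • windowSrc F k K hk Finset.univ l ∧
      QE (univDomains F k K hk) (imBond F K fun b => (((F.P K).eta (k + 1))⁻¹ : ℂ) *
          (((Y b : lieSU (Fin 2)) : Matrix (Fin 2) (Fin 2) ℂ) i i' - (φ₀ b.tgt i i' - φ₀ b.src i i'))) =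
        (θ.ρ8 (θ.bV a) i i').im • windowSrc F k K hk Finset.univ l := by
  letI := θ.instVβ₁; letI := θ.instVβ₂
  have hΨd : DifferentiableAt ℝ (msChart F 2 K (k + 1) (atScale (k + 1)) (avgFamily (avOfRecord F 2 K) 1) (1 : GaugeField (F.P K) 0 (SU 2))) 0 :=
    (contDiffAt_msChart_flat F K k).differentiableAt (by simp)
  have hΨX : HasFDerivAt (msChart F 2 K (k + 1) (atScale (k + 1)) (avgFamily (avOfRecord F 2 K) 1) (1 : GaugeField (F.P K) 0 (SU 2)))
      (fderiv ℝ (msChart F 2 K (k + 1) (atScale (k + 1)) (avgFamily (avOfRecord F 2 K) 1) (1 : GaugeField (F.P K) 0 (SU 2))) 0) (X 0) := by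
    rw [hX₀]; exact hΨd.hasFDerivAt
  have hcomp : HasFDerivAt
      (fun B => msChart F 2 K (k + 1) (atScale (k + 1)) (avgFamily (avOfRecord F 2 K) 1) (1 : GaugeField (F.P K) 0 (SU 2)) (X B))
      ((fderiv ℝ (msChart F 2 K (k + 1) (atScale (k + 1)) (avgFamily (avOfRecord F 2 K) 1) (1 : GaugeField (F.P K) 0 (SU 2))) 0).comp (fderiv ℝ X 0))
      (0 : Fin (F.P K).d → Site (F.P K) (k + 1) → θ.Vβ) := hΨX.comp 0 hXd.hasFDerivAt
  rw [hcomp.fderiv, ContinuousLinearMap.coe_comp, Function.comp_apply] at hY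
  exact exists_blockGauge_QE_eq_of_qLin_eq F hk Y (θ.ρ8 (θ.bV a)) l fun c =>
    (qLin_eq_of_fderiv_msChart_flat_eq F K k Y _ hY c).trans (qLin_fderiv_respDir_eq F θ K k hρ8 X hX₀ hXd hV a l c)

/-- ★★ **THE MOD-GAUGE TANGENT SOCKET** (entry level; pure logic — the twin of ✓`chartResponseWeaklyCritical_of_tangentData` with the constraint dictionary weakened to its MOD-GAUGE
edition «… ⟹ ∃ φ₀, rows of `Y − ∂φ₀`»): tangent data, flat tangent-criticality, the linearised fibre condition, (J-crit′) and (J-cons″) give `ChartResponseCriticalModGaugeAt` (the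
chart twin of (C-wcg), receipts via ✓`criticalModGauge_iff_chart`).  The criticality clause is blind to `φ₀` (✓`dcE_reBond_mul_sub_grad`). [cite: Balaban1985Variational, (176)–(178) p.306,
(36)–(37) p.283, (82)–(83) p.290; Balaban1984PropagatorsII, (2.7)–(2.8) p.224, (2.35) p.228] -/
theorem chartResponseCriticalModGauge_of_tangentData (k K : ℕ)
    (U : (Fin (F.P K).d → Site (F.P K) (k + 1) → θ.Vβ) → GaugeField (F.P K) 0 (SU 2))
    {X V' : Type*} [NormedAddCommGroup X] [NormedSpace ℝ X] [NormedAddCommGroup V'] [NormedSpace ℝ V']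
    (ent : X → PBond (F.P K) 0 → Fin 2 → Fin 2 → ℂ) (Y₀ : (Fin (F.P K).d → Site (F.P K) (k + 1) → θ.Vβ) → X)
    (hent : ∀ (a : θ.ιβ) (l : RespLabel F k K) (b : PBond (F.P K) 0) (i i' : Fin 2),
      chartRespD F θ k K U a l b i i' = ent (Y₀ (respDir F θ k K a l)) b i i')
    (L : X →L[ℝ] V') (a₂ : X →L[ℝ] X →L[ℝ] ℝ) (Dd : (Fin (F.P K).d → Site (F.P K) (k + 1) → θ.Vβ) → V')
    (hcrit : ∀ v t, L t = 0 → a₂ (Y₀ v) t = 0) (hcons : ∀ v, L (Y₀ v) = Dd v)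
    (Jcrit : ∀ hk : k + 1 ≤ (F.P K).m + (F.P K).K, ∀ (i i' : Fin 2) (w : BondSpace (F.P K)), QE (univDomains F k K hk) w = 0 →
      (∃ t, L t = 0 ∧ ∀ Y, ⟪dcE 1 (reBond F K fun b => (((F.P K).eta (k + 1))⁻¹ : ℂ) * ent Y b i i'), dcE 1 w⟫_ℝ = a₂ Y t) ∧
      (∃ t, L t = 0 ∧ ∀ Y, ⟪dcE 1 (imBond F K fun b => (((F.P K).eta (k + 1))⁻¹ : ℂ) * ent Y b i i'), dcE 1 w⟫_ℝ = a₂ Y t))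
    (JconsMG : ∀ hk : k + 1 ≤ (F.P K).m + (F.P K).K, ∀ (a : θ.ιβ) (l : RespLabel F k K) (Y : X),
      L Y = Dd (respDir F θ k K a l) → ∃ φ₀ : Site (F.P K) 0 → Fin 2 → Fin 2 → ℂ, ∀ i i' : Fin 2,
      QE (univDomains F k K hk) (reBond F K fun b => (((F.P K).eta (k + 1))⁻¹ : ℂ) * (ent Y b i i' - (φ₀ b.tgt i i' - φ₀ b.src i i'))) =
          (θ.ρ8 (θ.bV a) i i').re • windowSrc F k K hk Finset.univ l ∧
        QE (univDomains F k K hk) (imBond F K fun b => (((F.P K).eta (k + 1))⁻¹ : ℂ) * (ent Y b i i' - (φ₀ b.tgt i i' - φ₀ b.src i i'))) =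
          (θ.ρ8 (θ.bV a) i i').im • windowSrc F k K hk Finset.univ l)
    (a : θ.ιβ) (l : RespLabel F k K) : ChartResponseCriticalModGaugeAt F θ k K U a l := by
  letI := θ.instVβ₁; letI := θ.instVβ₂
  by_cases hk : k + 1 ≤ (F.P K).m + (F.P K).K
  swap
  · exact ⟨fun _ _ _ => 0, fun hk' => absurd hk' hk⟩
  obtain ⟨φ₀, hφ₀⟩ := JconsMG hk a l (Y₀ (respDir F θ k K a l)) (hcons _)
  refine ⟨φ₀, fun hk' i i' => ?_⟩
  have hξ : (((F.P K).eta (k + 1))⁻¹ : ℂ) = (((F.P K).eta (k + 1))⁻¹ : ℝ) := by push_cast; rfl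
  have hfun : (fun b : PBond (F.P K) 0 => (((F.P K).eta (k + 1))⁻¹ : ℂ) * (chartRespD F θ k K U a l b i i' - (φ₀ b.tgt i i' - φ₀ b.src i i'))) =
      fun b => (((F.P K).eta (k + 1))⁻¹ : ℂ) * (ent (Y₀ (respDir F θ k K a l)) b i i' - (φ₀ b.tgt i i' - φ₀ b.src i i')) := by
    funext b; rw [hent]
  have hc := dcE_reBond_mul_sub_grad F K ((F.P K).eta (k + 1))⁻¹ (fun b => ent (Y₀ (respDir F θ k K a l)) b i i') (fun y => φ₀ y i i')
  rw [← hξ] at hc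
  obtain ⟨h1, h2⟩ := hφ₀ i i'
  rw [hfun]
  refine ⟨⟨h1, fun w hw => ?_⟩, ⟨h2, fun w hw => ?_⟩⟩
  · rw [hc.1]
    obtain ⟨⟨t, ht, hY⟩, -⟩ := Jcrit hk i i' w hw
    rw [hY]; exact hcrit _ t ht
  · rw [hc.2]
    obtain ⟨-, ⟨t, ht, hY⟩⟩ := Jcrit hk i i' w hw
    rw [hY]; exact hcrit _ t ht

/-- ★★★ **THE FOUR ROOTED RECEIPTS FROM THE CHART TWIN OF (C-wcg)** (any chart): factorisation + chart regularity + `ChartResponseCriticalModGaugeAt` ⟹ (C-wcg) ∧ (C-orb) ∧ (C-crit) ∧ (C-cons)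
on `k + 1 ≤ m + K` (✓`criticalModGauge_iff_chart`, ✓`rootedResponseOrbitAt_of_criticalModGauge`, ✓`criticalModGauge_iff_invCritical_and_constraintModGauge`). [cite: Balaban1985Variational,
(176)–(178) p.306, (19) p.281; Balaban1984PropagatorsII, (2.35) p.228; Balaban1987RG1, (4.35) p.290] -/
theorem rootedReceipts_of_chart_criticalModGauge (k K : ℕ) (hk : k + 1 ≤ (F.P K).m + (F.P K).K)
    (U : (Fin (F.P K).d → Site (F.P K) (k + 1) → θ.Vβ) → GaugeField (F.P K) 0 (SU 2))
    (hfac : RootFactorAt F θ k K U) (hreg : ChartRegAt F θ k K U) (a : θ.ιβ) (l : RespLabel F k K)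
    (h : ChartResponseCriticalModGaugeAt F θ k K U a l) :
    RootedResponseCriticalModGaugeAt F θ k K a l ∧ RootedResponseOrbitAt F θ k K a l ∧
      RootedResponseInvCriticalAt F θ k K a l ∧ RootedResponseConstraintModGaugeAt F θ k K a l :=
  have hw := (criticalModGauge_iff_chart F θ k K U hfac hreg a l).2 h
  ⟨hw, rootedResponseOrbitAt_of_criticalModGauge F θ k K hk a l hw,
    (criticalModGauge_iff_invCritical_and_constraintModGauge F θ k K a l).1 hw⟩

/-- ★★★ **THE MOD-GAUGE SOCKET PLUGGED INTO A FLAT TANGENT-CRITICAL EXP-CHART FAMILY** (generic `Ψ`; the twin of ✓`chartResponseWeaklyCritical_of_flatCriticalExpChartFamily` with (J-cons′)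
WEAKENED to its mod-gauge edition (J-cons″) «`DΨ(0)Y = D datum(0)(respDir a l)` ⟹ ∃ φ₀, the [B6]-rows of `Y − ∂φ₀`»): ⟹ `ChartResponseCriticalModGaugeAt` for `B ↦ expChart 1 (X B)`, all `a l`.
[cite: Balaban1985Variational, (176)–(178) p.306, (82)–(83) p.290, (36) p.283; Balaban1984PropagatorsII, (2.35) p.228; Balaban1987RG1, (4.35) p.290] -/
theorem chartResponseCriticalModGauge_of_flatCriticalExpChartFamily (k K : ℕ) {V : Type*} [NormedAddCommGroup V] [NormedSpace ℝ V] [FiniteDimensional ℝ V]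
    (X : (Fin (F.P K).d → Site (F.P K) (k + 1) → θ.Vβ) → PBond (F.P K) 0 → lieSU (Fin 2))
    (Ψ : (PBond (F.P K) 0 → lieSU (Fin 2)) → V) (datum : (Fin (F.P K).d → Site (F.P K) (k + 1) → θ.Vβ) → V)
    (hfam : FlatCriticalExpChartFamilyAt F θ k K X Ψ datum) (Jcrit : FlatCritDictionary F k K Ψ)
    (JconsMG : letI := θ.instVβ₁; letI := θ.instVβ₂;
      ∀ hk : k + 1 ≤ (F.P K).m + (F.P K).K, ∀ (a : θ.ιβ) (l : RespLabel F k K) (Y : PBond (F.P K) 0 → lieSU (Fin 2)),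
      fderiv ℝ Ψ 0 Y = fderiv ℝ datum 0 (respDir F θ k K a l) → ∃ φ₀ : Site (F.P K) 0 → Fin 2 → Fin 2 → ℂ, ∀ i i' : Fin 2,
      QE (univDomains F k K hk) (reBond F K fun b => (((F.P K).eta (k + 1))⁻¹ : ℂ) *
          (((Y b : lieSU (Fin 2)) : Matrix (Fin 2) (Fin 2) ℂ) i i' - (φ₀ b.tgt i i' - φ₀ b.src i i'))) =
        (θ.ρ8 (θ.bV a) i i').re • windowSrc F k K hk Finset.univ l ∧
      QE (univDomains F k K hk) (imBond F K fun b => (((F.P K).eta (k + 1))⁻¹ : ℂ) *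
          (((Y b : lieSU (Fin 2)) : Matrix (Fin 2) (Fin 2) ℂ) i i' - (φ₀ b.tgt i i' - φ₀ b.src i i'))) =
        (θ.ρ8 (θ.bV a) i i').im • windowSrc F k K hk Finset.univ l)
    (a : θ.ιβ) (l : RespLabel F k K) :
    ChartResponseCriticalModGaugeAt F θ k K (fun B => expChart (1 : GaugeField (F.P K) 0 (SU 2)) (X B)) a l := by
  letI := θ.instVβ₁; letI := θ.instVβ₂
  obtain ⟨hX₀, hXd, hΨd, hΨ₂d, hsurj, hcrit, hfib⟩ := hfam
  obtain ⟨h1, h2, h3⟩ := flatCritical_tangentData (P := F.P K) hX₀ hXd.hasFDerivAt hΨd hΨ₂d.hasFDerivAt hsurj hcrit hfib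
  refine chartResponseCriticalModGauge_of_tangentData F θ k K (fun B => expChart (1 : GaugeField (F.P K) 0 (SU 2)) (X B))
    (fun (Y : PBond (F.P K) 0 → lieSU (Fin 2)) (b : PBond (F.P K) 0) (i i' : Fin 2) => ((Y b : lieSU (Fin 2)) : Matrix (Fin 2) (Fin 2) ℂ) i i')
    (fun v => fderiv ℝ X 0 v) (fun a l b i i' => ?_) (fderiv ℝ Ψ 0)
    (fderiv ℝ (fun Y => fderiv ℝ (fun Y : PBond (F.P K) 0 → lieSU (Fin 2) => wilsonAction4 (expChart (1 : GaugeField (F.P K) 0 (SU 2)) Y)) Y) 0)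
    (fun v => fderiv ℝ datum 0 v) (fun v t ht => h1 v t ht) (fun v => h2 v) Jcrit (fun hk a l Y hY => JconsMG hk a l Y hY) a l
  exact (chartRespD_eq_fderiv_respDir F θ k K _ a l b i i').trans (h3 _ b i i')

/-- ★★★ **THE SOCKET PLUGGED AT `Ψ₀` WITH NO DICTIONARY DISPLAYED**: a flat tangent-critical exp-chart family for the canonical flat log chart `Ψ₀` + the KNIT `range` token's eventual
identity `hV` + `ρ₈ ∈ 𝔰𝔲(2)` ⟹ `ChartResponseCriticalModGaugeAt` for `B ↦ expChart 1 (X B)`, all `a l` — (J-crit′)@`Ψ₀` is DEF-1's ✓`flatCritDictionary_flatLogChart`, (J-cons″)@`Ψ₀` is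
★★★`flatConsModGauge_msChart_flat`. [cite: Balaban1985Variational, (176)–(178) p.306, (82)–(83) p.290, (44)–(48) p.285; Balaban1984PropagatorsII, (2.35) p.228; Balaban1987RG1, (4.35) p.290] -/
theorem chartResponseCriticalModGauge_of_flatCriticalExpChartFamily_flatLogChart (K k : ℕ)
    (hρ8 : letI := θ.instVβ₁; letI := θ.instVβ₂; ∀ v : θ.Vβ, θ.ρ8 v ∈ lieSU (Fin 2))
    (X : (Fin (F.P K).d → Site (F.P K) (k + 1) → θ.Vβ) → PBond (F.P K) 0 → lieSU (Fin 2))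
    (datum : (Fin (F.P K).d → Site (F.P K) (k + 1) → θ.Vβ) → Fin (constrCard (atScale (k + 1) : DetSet (F.P K)) (k + 1)) → lieSU (Fin 2))
    (hfam : FlatCriticalExpChartFamilyAt F θ k K X
      (msChart F 2 K (k + 1) (atScale (k + 1)) (avgFamily (avOfRecord F 2 K) 1) (1 : GaugeField (F.P K) 0 (SU 2))) datum)
    (hV : letI := θ.instVβ₁; letI := θ.instVβ₂;
      ∀ᶠ B in 𝓝 (0 : Fin (F.P K).d → Site (F.P K) (k + 1) → θ.Vβ),
        avgFamily (avOfRecord F 2 K) (expChart (1 : GaugeField (F.P K) 0 (SU 2)) (X B)) (k + 1) = unitField F θ k K B)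
    (a : θ.ιβ) (l : RespLabel F k K) :
    ChartResponseCriticalModGaugeAt F θ k K (fun B => expChart (1 : GaugeField (F.P K) 0 (SU 2)) (X B)) a l := by
  letI := θ.instVβ₁; letI := θ.instVβ₂
  refine chartResponseCriticalModGauge_of_flatCriticalExpChartFamily F θ k K X _ datum hfam (flatCritDictionary_flatLogChart F k K)
    (fun hk a l Y hY => flatConsModGauge_msChart_flat F θ K k hk hρ8 X hfam.1 hfam.2.1 hV a l Y ?_) a l
  have hfib : (fun B => msChart F 2 K (k + 1) (atScale (k + 1)) (avgFamily (avOfRecord F 2 K) 1) (1 : GaugeField (F.P K) 0 (SU 2)) (X B))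
      =ᶠ[𝓝 (0 : Fin (F.P K).d → Site (F.P K) (k + 1) → θ.Vβ)] datum := hfam.2.2.2.2.2.2
  rw [hfib.fderiv_eq]
  exact hY

/-- ★★★ **ROOTED RECEIPTS FROM THE TANGENT-FORM TOKEN AT `Ψ₀`, NO (J-cons′)** (twin of ✓`rootedReceipts_of_flatExpChartFamily`). [cite: Balaban1985Variational, (19) p.281, (174) p.305,
(177)–(182) p.306–307; Balaban1987RG1, (1.1) p.260, (2.3)–(2.4) p.265] -/
theorem rootedReceipts_of_flatExpChartFamily_flatLogChart (K k : ℕ) (hk : k + 1 ≤ (F.P K).m + (F.P K).K)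
    (U : (Fin (F.P K).d → Site (F.P K) (k + 1) → θ.Vβ) → GaugeField (F.P K) 0 (SU 2)) (hfac : RootFactorAt F θ k K U)
    (hρ8 : letI := θ.instVβ₁; letI := θ.instVβ₂; ∀ v : θ.Vβ, θ.ρ8 v ∈ lieSU (Fin 2))
    (X : (Fin (F.P K).d → Site (F.P K) (k + 1) → θ.Vβ) → PBond (F.P K) 0 → lieSU (Fin 2))
    (datum : (Fin (F.P K).d → Site (F.P K) (k + 1) → θ.Vβ) → Fin (constrCard (atScale (k + 1) : DetSet (F.P K)) (k + 1)) → lieSU (Fin 2))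
    (hUX : letI := θ.instVβ₁; letI := θ.instVβ₂;
      U =ᶠ[𝓝 (0 : Fin (F.P K).d → Site (F.P K) (k + 1) → θ.Vβ)] fun B => expChart (1 : GaugeField (F.P K) 0 (SU 2)) (X B))
    (hfam : FlatCriticalExpChartFamilyAt F θ k K X
      (msChart F 2 K (k + 1) (atScale (k + 1)) (avgFamily (avOfRecord F 2 K) 1) (1 : GaugeField (F.P K) 0 (SU 2))) datum)
    (hV : letI := θ.instVβ₁; letI := θ.instVβ₂;
      ∀ᶠ B in 𝓝 (0 : Fin (F.P K).d → Site (F.P K) (k + 1) → θ.Vβ),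
        avgFamily (avOfRecord F 2 K) (expChart (1 : GaugeField (F.P K) 0 (SU 2)) (X B)) (k + 1) = unitField F θ k K B)
    (a : θ.ιβ) (l : RespLabel F k K) :
    RootedResponseCriticalModGaugeAt F θ k K a l ∧ RootedResponseOrbitAt F θ k K a l ∧
      RootedResponseInvCriticalAt F θ k K a l ∧ RootedResponseConstraintModGaugeAt F θ k K a l := by
  letI := θ.instVβ₁; letI := θ.instVβ₂
  have hfac' : RootFactorAt F θ k K (fun B => expChart (1 : GaugeField (F.P K) 0 (SU 2)) (X B)) := rootFactorAt_congr F θ k K hfac hUX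
  have hreg : ChartRegAt F θ k K (fun B => expChart (1 : GaugeField (F.P K) 0 (SU 2)) (X B)) := chartRegAt_expChart F θ k K hfam.1 hfam.2.1
  exact rootedReceipts_of_chart_criticalModGauge F θ k K hk _ hfac' hreg a l
    (chartResponseCriticalModGauge_of_flatCriticalExpChartFamily_flatLogChart F θ K k hρ8 X datum hfam hV a l)

end ModGaugeSocket

/-! ## §5  THE (R-a) ROAD AT `Ψ₀` WITH A CONTENTFUL FINAL: KNIT tokens + (s-exp) + `ρ₈ ∈ 𝔰𝔲(2)` ⟹ the four rooted receipts ∧ TokP9reg♭ᵣ (`k + 2 ≤ m + K`; no dictionary displayed) -/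

section FlatLogChartFinal

open T4AdjointCovarianceUnitary (lieSU expSU coe_expSU)
open B15DeterminingSets (DetSet MSField AgreeOn avgFamily atScale agreeOn_atScale_iff)

/-- ★★★★ **THE (R-a) ROAD AT THE FLAT LOG CHART, (J-cons′) REMOVED** (replaces the vacuous-as-typed finals ✓`rootedReceipts_of_tokens_atScale_flatLogChart` ∕ `…_onto`): DISPLAYED =
`k + 2 ≤ m + K` · N07's KNIT tokens `(Kc range covers sol_of_isMinOn star_mem star_isMinOn)` + `RegimeTok` + domain letter · (s-exp) `hSX` with `X 0 = 0`, `X ∈ C²` at `0` ·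
`ρ₈ ∈ 𝔰𝔲(2)`.  DERIVED: the `Ψ₀`-letters (§4g–§4i of the road: ✓`contDiffAt_msChart_flat`, ✓`surjective_fderiv_msChart_flat_atScale`, ✓`eventually_avgFamily_eq_of_msChart_flat_eq_pair`,
✓`psiLetter_near_of_pointwise`), (J-crit′) at `Ψ₀` (DEF-1's ✓`flatCritDictionary_flatLogChart`), (J-cons″) at `Ψ₀` (§4 above), the family token (✓Near ∕ ✓Dock).
⟹ (∀ a l, the four rooted receipts) ∧ TokP9reg♭ᵣ.  CONDITIONAL on the displayed KNIT ∕ (s-exp) letters; nothing of [15] asserted beyond the tree's theorems.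
[cite: Balaban1985Variational, Thm 1 p.279, (44)–(48) p.285, Prop. 6 p.295, (82)–(83) p.290, Prop. 8 p.304, Prop. 9 p.309, (174) p.305, (177)–(182) pp.306–307; Balaban1985RegularSpaces,
(1.113)–(1.114) pp.95–97; Balaban1987RG1, (1.20) p.264, (4.35) p.290; Balaban1988Convergent, (2.10)–(2.13) pp.256–257] -/
theorem rootedReceipts_of_tokens_atScale_flatLogChart_modGauge {𝒴 𝒵 : Type} [NormedAddCommGroup 𝒴] [NormedSpace ℂ 𝒴] [CompleteSpace 𝒴]
    [NormedAddCommGroup 𝒵] [NormedSpace ℂ 𝒵]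
    (k K : ℕ) (hk2 : k + 2 ≤ (F.P K).m + (F.P K).K) (S : BgScheme F 2 𝒴 𝒵 K (k + 1))
    (hR : S.RegimeTok) (Kc : GaugeField (F.P K) (k + 1) (SU 2) → Set 𝒴)
    (range : ∀ V ∈ S.dom, ∀ A ∈ Kc V, S.chart V A ∈ bgReg F 2 K (k + 1) θ.εbg ∧ Averaging.iter (avOfRecord F 2 K) (k + 1) (S.chart V A) = V)
    (covers : ∀ V ∈ S.dom, ∀ U : GaugeField (F.P K) 0 (SU 2), U ∈ bgReg F 2 K (k + 1) θ.εbg →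
      Averaging.iter (avOfRecord F 2 K) (k + 1) U = V → ∃ A ∈ Kc V, OrbitRel (k + 1) (S.chart V A) U)
    (sol_of_isMinOn : ∀ V ∈ S.dom, ∀ A ∈ Kc V, IsMinOn (wilsonAction4 ∘ S.chart V) (Kc V) A →
      ‖A‖ ≤ S.ε₄ ∧ mapT (S.𝒢 V) 0 (S.W V) (S.J V) (S.𝔄 V) A = A)
    (star_mem : ∀ V ∈ S.dom, S.sol V ∈ Kc V) (star_isMinOn : ∀ V ∈ S.dom, IsMinOn (wilsonAction4 ∘ S.chart V) (Kc V) (S.sol V))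
    (hdom : letI := θ.instVβ₁; letI := θ.instVβ₂;
      ∀ᶠ B in 𝓝 (0 : Fin (F.P K).d → Site (F.P K) (k + 1) → θ.Vβ), unitField F θ k K B ∈ S.dom)
    (W : (Fin (F.P K).d → Site (F.P K) (k + 1) → θ.Vβ) → MSField (F.P K) (SU 2)) (hW : ∀ B, W B (k + 1) = unitField F θ k K B)
    (X : (Fin (F.P K).d → Site (F.P K) (k + 1) → θ.Vβ) → PBond (F.P K) 0 → lieSU (Fin 2))
    (hSX : letI := θ.instVβ₁; letI := θ.instVβ₂;
      (fun B => S.chartCfg (unitField F θ k K B)) =ᶠ[𝓝 (0 : Fin (F.P K).d → Site (F.P K) (k + 1) → θ.Vβ)]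
        fun B => expChart (1 : GaugeField (F.P K) 0 (SU 2)) (X B))
    (hX₀ : letI := θ.instVβ₁; letI := θ.instVβ₂; X 0 = 0) (hXc : letI := θ.instVβ₁; letI := θ.instVβ₂; ContDiffAt ℝ 2 X 0)
    (hρ8 : letI := θ.instVβ₁; letI := θ.instVβ₂; ∀ v : θ.Vβ, θ.ρ8 v ∈ lieSU (Fin 2)) :
    (∀ (a : θ.ιβ) (l : RespLabel F k K),
      RootedResponseCriticalModGaugeAt F θ k K a l ∧ RootedResponseOrbitAt F θ k K a l ∧
        RootedResponseInvCriticalAt F θ k K a l ∧ RootedResponseConstraintModGaugeAt F θ k K a l) ∧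
    letI := θ.instVβ₁; letI := θ.instVβ₂
    ContDiffAt ℝ 2 (fun B : Fin (F.P K).d → Site (F.P K) (k + 1) → θ.Vβ =>
      fun (b : PBond (F.P K) 0) (i i' : Fin 2) => ((recordBgField F θ k K B b : SU 2) : Matrix (Fin 2) (Fin 2) ℂ) i i') 0 := by
  letI := θ.instVβ₁; letI := θ.instVβ₂
  have hk : k + 1 ≤ (F.P K).m + (F.P K).K := by omega
  have hV := eventually_avgFamily_expChart_eq_unitField F θ k K S Kc range star_mem hdom X hSX
  have hmem : ∀ᶠ B in 𝓝 (0 : Fin (F.P K).d → Site (F.P K) (k + 1) → θ.Vβ),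
      avgFamily (avOfRecord F 2 K) (expChart (1 : GaugeField (F.P K) 0 (SU 2)) (X B)) (k + 1) = W B (k + 1) :=
    hV.mono fun B hB => by rw [hB, hW]
  have hΨ := contDiffAt_msChart_flat F (N := 2) K k
  have hsub := psiLetter_near_of_pointwise F k K W X _ hX₀ hXc.continuousAt hΨ (surjective_fderiv_msChart_flat_atScale F K k hk2)
    (eventually_avgFamily_eq_of_msChart_flat_eq_pair F K k) hmem
  have hfac := rootFactorAt_of_tokens_chart F θ k K hk S hR Kc range covers sol_of_isMinOn star_mem star_isMinOn hdom
  have hco := eventually_isCritOnFibre_expChart_of_tokens F θ k K S Kc range covers star_mem star_isMinOn hdom W hW X hSX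
  have hnear : FlatCritOnFibreExpChartFamilyNearAt F θ k K (atScale (k + 1)) W X
      (msChart F 2 K (k + 1) (atScale (k + 1)) (avgFamily (avOfRecord F 2 K) 1) (1 : GaugeField (F.P K) 0 (SU 2)))
      (fun B => msChart F 2 K (k + 1) (atScale (k + 1)) (avgFamily (avOfRecord F 2 K) 1) (1 : GaugeField (F.P K) 0 (SU 2)) (X B)) :=
    ⟨hX₀, hXc.differentiableAt (by norm_num), differentiableAt_fderiv_of_contDiffAt_of_two hΨ, hco, hsub, Filter.Eventually.of_forall fun _ => rfl⟩
  exact ⟨fun a l => rootedReceipts_of_flatExpChartFamily_flatLogChart F θ K k hk _ hfac hρ8 X _ hSX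
      (flatCriticalExpChartFamilyAt_of_critOnFibreNear F θ k K hnear) hV a l,
    tokP9reg_of_expChartFamily F θ k K _ hfac X hSX hXc⟩

/-- Corollary of ✓`not_flatConsDictionary_msChart_flat` with its displayed onto-ness discharged (`k + 2 ≤ m + K`, ✓`surjective_fderiv_msChart_flat_atScale`): the EXACT (J-cons′) at `Ψ₀` is
uninhabitable whatever the datum — recorded next to its MOD-GAUGE repair ★★★`flatConsModGauge_msChart_flat`. [cite: Balaban1985Variational, (44)–(48) p.285; Balaban1984PropagatorsII, (2.6) p.224] -/
theorem not_flatConsDictionary_msChart_flat_of_le (K k : ℕ) (hk2 : k + 2 ≤ (F.P K).m + (F.P K).K) (a : θ.ιβ) (l : RespLabel F k K)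
    (datum : (Fin (F.P K).d → Site (F.P K) (k + 1) → θ.Vβ) → Fin (constrCard (atScale (k + 1) : DetSet (F.P K)) (k + 1)) → lieSU (Fin 2)) :
    ¬ FlatConsDictionary F θ k K (msChart F 2 K (k + 1) (atScale (k + 1)) (avgFamily (avOfRecord F 2 K) 1) (1 : GaugeField (F.P K) 0 (SU 2))) datum :=
  not_flatConsDictionary_msChart_flat F θ K k (by omega) (surjective_fderiv_msChart_flat_atScale F K k hk2) a l datum

end FlatLogChartFinal

end Summit.QuantumFields.YangMills.Theorems.K0AxCtabUniq

end
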